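import Summits.ResolutionOfSingularities.ResolutionOfSingularities.Theorems.DeltaCutJunction
import Literature.AlgebraicGeometry.Resolution.BlowupDisjointCentreSplitting
import Literature.AlgebraicGeometry.Resolution.Hironaka2005BasicFactsRegularEquiv
import HarnessLib

/-!
# DeltaCutChain — decomp-res node «ChainCut» (lens-6 g24, critic row 185 CLEARED DECIDED +1 · MAP 0), tree file 1/5 of the node

Content VERBATIM from the decomp-res lens-6 g24 node `HOME/decomp-res-lens-6/g24/ChainCut.lean` (pin dd25c369, 1167
l; HOME = run/shared/lean/pub/decomp-res): the node imports the LANDED tree only (g23's `DeltaCutJunction` chain +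
the Literature splitting / equimultiplicity files) and CARRIES NOTHING — every declaration is new, same namespace
`…Theorems.DeltaCutClasses`.  Farm (node, critic's own run): rc 0 · 0 err · 0 warn · 0 sorry · axioms std.  Critic:
CRITIC-LEDGER row 185 CLEARED DECIDED +1 · MAP 0 (the δ-law AT THE NEAR POINT: `E1TopDeltaHeavy ⟺ E1TopChainHeavy
[RESIDUAL] ∧ E1TopDeltaHeavyChainTame [DECIDED from E 5]`, hypothesis-free and exact).  Landing orders = the lens's
riders INBOX :962/:964 endorsed by the critic rider INBOX :980: (A) `DeltaCutChain` = §ChainDefs + §ChainCells +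
§ChainEngine + §ChainSubCells + §ChainExactness, (B) `DeltaCutChainCertificates` = §ChainCertificates (imports (A));
both VERBATIM, `--kind proof --supports stmt-ResolutionOfSingularities-26971`; the 12+ `def … : Prop` / `Set`
declarations are THIS node's cells / predicates / loci (none is a vendored fact).  Aside bookkeeping (rider): ONE
aside SWITCH on the lens-6 column — `E1TopChainHeavy` (home `DeltaCutChain`) SUPERSEDES the g23 aside
`DCE1TopDeltaHeavy` (item 28044).

The lens header, verbatim:

> # ChainCut (decomp-res-lens-6 · g24 · axis (S) of CRITIC-LEDGER row 181): THE δ-LAW AT THE NEAR POINT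
>
> NODE «ChainCut».  Target = the column's located residual after g23, `DeltaCutClasses.E1TopDeltaHeavy` («some wild
closed top point
> HAS A NEAR POINT», exact by `topDeltaHeavy_iff_exists_near`; whole-core aside of item stmt-…-26971 / 27588).
IMPORTS THE LANDED
> TREE ONLY (g23's `DeltaCutJ.lean` 9b3a0295 =
`Theorems/DeltaCutLaw·LawB·Adapted·Law2·Law2B·Cells·Certificates·Junction`, plus the two
> Literature splitting/equimultiplicity files) and CARRIES NOTHING: every declaration below (§S, `section ChainDefs` … `section
> ChainCertificates`, same namespace `DeltaCutClasses`) is new.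
>
> THESIS of the cut (kernel δ-control law AT THE NEAR POINT, one located cut, rule (C)).  Call a point BAD if it is
a wild closed top
> point that is not δ-light (= has a near point, by (N)).  Two letters on a bad point `y`:
> * CHAIN letter `ChainLightAt 𝓘 n y`: every WILD near point `y'` of `y` (over any regular centre supported at
`{y}`) is δ-LIGHT —
>   the g23 law (N) `noNearPointOver_iff_deltaLightAt` evaluated AT `y'`: no wild near point of `y` has itself a near point;
> * FINITENESS letter: the bad set is FINITE — exactly what a one-shot centre of closed points consumes (isolation
of every bad point
>   in the top locus, tree `ForcedTowerClasses.IsIsolatedIn`, is a SUFFICIENT criterion: `badSet_finite_of_isolated`).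
> Then, HYPOTHESIS-FREE and EXACT: `E1TopDeltaHeavy ⟺ E1TopChainHeavy [RESIDUAL] ∧ E1TopDeltaHeavyChainTame [DECIDED]`
> (`e1TopDeltaHeavy_iff_chainHeavy_chainTame`), the decided cell is PROVED from `E 5`
(`e1TopDeltaHeavyChainTame_of_five`) by the
> ONE-SHOT ENGINE `wor_of_chainTame` (blow up the regular finite centre `∏_{y ∈ S} 𝔪_y` of the finite bad set `S` AT
ONCE; by blow-up SPLITTING `IsBlowup.exists_fac_of_mul` + `controlledTransform_comp_of_disjoint`
> the points over a bad point `y₀` are read through the point blow-up at `y₀` alone, where the chain letter makes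
every wild point
> δ-light; off the centre δ-lightness is transported by the g23 stalk transports; close with g23's
`wor_of_splitOrLightOrDeltaLight`),
> so the residual is RE-LOCATED EXACTLY: `e1TopDeltaHeavy_iff_e1TopChainHeavy (h5 : E 5)`,
`e1TopHeavy_iff_e1TopChainHeavy (h5 : E 5)`.
>
> EXACTNESS of the new residual locus (kernel, both directions): `not_chainLightAt_iff_exists_wild_near_chain` — `¬
ChainLightAt ⟺`
> «a WILD near point `y'` of `y` which itself HAS a near point» (a δ-HEAVY WILD NEAR-POINT CHAIN OF LENGTH 2), `mem_badSet_iff`,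
> `topChainHeavy_iff_exists`, `topBadInfinite_iff_infinite`, `topFiniteChainHeavy_iff_exists`; the residual splits BY LETTER
> (0-weight, typed, DISJOINT, hyp-free `topChainHeavy_iff_badInfinite_or_finiteChainHeavy`) into the INFINITE-BAD-SET kind
> `WORTopBadInfinite` (infinitely many bad points — a curve of them) and the FINITE-CHAIN kind
`WORTopFiniteChainHeavy` (finitely many bad
> points, one chain-heavy), `worTopChainHeavy_iff_badInfinite_finiteChainHeavy`.
>
> CERTIFIED INHABITANTS (polynomial level, char 3, `n = 3`, format of g23 §R-c): DECIDED side — g23's δ-HEAVY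
residual inhabitant
> R2 = `z³+t⁴+u²w²` LEAVES the residual: `R2_chainTame_certificate` (Sing₃ = the origin, so the bad set is finite; near points =
> exactly the chart-`u`/`w` origins; both TAME: `∂²f' = 2u` resp. `2w`, a regular parameter — no wild near point,
chain letter vacuous);
> RESIDUAL side, finite-chain kind — B_S = `z³+t⁷+u⁷+w⁷`: `BS_chain_certificate` (Sing₃ = the origin; chart-`t`
origin `y'` is a near
> point in `3`-power form — WILD — and the chart-`u'` origin over `y'` is a near point of `y'`: a δ-heavy wild chain
of length 2);
> infinite kind — C_ax = `z³+t⁴+u⁴` (`Cax_curve_certificate`: the `w`-axis prime `P = (z,t,u) ∌ w` has `f ∈ z³ + P⁴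
⊆ P³`: every closed
> point of the axis is a wild δ-heavy top point — infinitely many bad points).
>
> WHY THE LETTERS ARE FORCED (not a costume).  (i) The numeric law «δ' ≤ δ» is FALSE at chart origins (CP 2019 Prop.
2.6 gives only
> `δ' ≥ δ − 1`), so the law is the PREDICATE (N) read at `y'`, not a number; (ii) the chain letter constrains WILD
near points only:
> R2's near points are absolute-contact points (TAME by `WORAllAbs`) and δ-HEAVY, so an all-near-points letter would
mis-file R2;
> (iii) the finiteness letter cannot be dropped: infinitely many bad points (C_ax: a CURVE of them) admit no centre
of closed points,
> and the class is DIFFERENT from lens-4's infinite towers `NoTowerWild n (…)` (finite length-2 chain; INBOX :891 no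
collision) and from
> their NOWHERE-isolated aside `NonIsolatedReduction` (here: SOMEWHERE infinitely many bad points).  Critic
pre-pricing INBOX :921.
>
> PORTS USED BY NAME: g23 (N) `noNearPointOver_iff_deltaLightAt`, `deltaLightAt_transform_iff_of_not_mem`,
> `idealOrder`/`isAbsContactAt_transform_iff_of_not_mem`, `wor_of_splitOrLightOrDeltaLight`; tree
`TwistCutClasses.orderUSC_holds`,
> `baseStable_holds`, `LightCutClasses.tame_successor_quartic`, `two_not_mem`, `derivation_pow_succ_mem`; Literature
> `IsBlowup.exists_fac_of_mul`, `IsBlowup.controlledTransform_comp_of_disjoint`, `vanishingIdeal_sup_eq_mul_of_disjoint`,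
> `isRegular_subscheme_mul_of_disjoint_support`, `Hironaka2005.idealOrder_controlledTransform_le_of_isRegular`.
>
> Farm: `lean check` rc 0 · 0 errors · 0 warnings · 0 sorries; axioms {propext, Classical.choice, Quot.sound} (see
`bc/Probe.lean`).
> No `instance`, no `notation`, no `sorry`.  All new `def`s are `Prop`-valued cells/predicates or `Set`-valued loci
under `Theorems`.

## This file

§S THE CHAIN CUT of the δ-heavy located residual `E1TopDeltaHeavy` (node l. 72–673): `section ChainDefs` (BAD points
= wild closed top points that are not δ-light: `badSet` / `badLocus`; the CHAIN letter `ChainLightAt` = every WILD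
near point is δ-light; `TopChainHeavy`), `section ChainCells` (the EXACT hypothesis-free carve
`WORTopDeltaHeavyChainTame` / `WORTopChainHeavy` / `E1TopDeltaHeavyChainTame` / **`E1TopChainHeavy`** — THE NEW
LOCATED RESIDUAL, the route aside's HOME is this file, cone-free — with `e1TopDeltaHeavy_iff_chainHeavy_chainTame`),
`section ChainEngine` (the ONE-SHOT ENGINE `wor_of_chainTame`: blow up the finite bad set AT ONCE, splitting
`IsBlowup.exists_fac_of_mul` + `controlledTransform_comp_of_disjoint`; `e1TopDeltaHeavyChainTame_of_five`; exact
re-location `e1TopDeltaHeavy_iff_e1TopChainHeavy (h5 : E 5)`, `e1TopHeavy_iff_e1TopChainHeavy`), `section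
ChainSubCells` (split BY LETTER, typed DISJOINT: INFINITE-BAD-SET kind `TopBadInfinite` / `WORTopBadInfinite` /
`E1TopBadInfinite`, FINITE-CHAIN kind `TopFiniteChainHeavy` / `WORTopFiniteChainHeavy` / `E1TopFiniteChainHeavy`),
`section ChainExactness` (`not_chainLightAt_iff_exists_wild_near_chain`, `mem_badSet_iff`,
`topChainHeavy_iff_exists`, `topBadInfinite_iff_infinite`, `topFiniteChainHeavy_iff_exists`) — continued in
`DeltaCutChain2`… where the 400-line cap cuts.  (This first part carries: `badSet`, `badLocus`,
`badSet_eq_badLocus`, `ChainLightAt`, `TopChainHeavy`, `topLocus_eq_support`, `badSet_subset_wildSet`,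
`topDeltaHeavy_of_topChainHeavy`, `not_topChainHeavy_iff`, `WORTopDeltaHeavyChainTame`, `WORTopChainHeavy`,
`E1TopDeltaHeavyChainTame`, `E1TopChainHeavy`, `worTopDeltaHeavy_iff_chainHeavy_chainTame`,
`e1TopDeltaHeavy_iff_chainHeavy_chainTame`, `badSet_finite_of_isolated`, `isClosed_of_finite_of_isClosed_singleton`.)

[WRITER NOTE (decomp-res writer g12): file split only (tree files ≤ 400 lines); namespace, sections, section
variables / opens and every declaration exactly as in the lens (the node's global dupNamespace-linter line is
dropped — the library sets it).]

(Sources: Hironaka1967 (characteristic polyhedra); CossartJannsenSaito2020 Def. 3.13 / Thm. 3.14, Ch. 8, Thm. 9.6;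
Hironaka1970 (near points / vertices); CossartPiltant2019 Prop. 2.6 (δ at chart origins); CossartPiltant2008 §2;
Giraud1975; Hironaka2005 (three key theorems: order under permissible blow-up); EGAIV4 §16–§17; StacksProject 0804 /
0BIQ / 031I; Matsumura1987 §28.)
-/

noncomputable section

open CategoryTheory CategoryTheory.Limits AlgebraicGeometry TopologicalSpace IsLocalRing
open Literature.AlgebraicGeometry.Resolution

universe u

namespace Summit.ResolutionOfSingularities.ResolutionOfSingularities.Theorems.DeltaCutClasses

open Summit.ResolutionOfSingularities.ResolutionOfSingularities.Theorems.TwistCutClasses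
open Summit.ResolutionOfSingularities.ResolutionOfSingularities.Theorems.LightCutClasses

section ChainDefs

open Summit.ResolutionOfSingularities.ResolutionOfSingularities.Theorems
open WeakOrderReduction ForcedTowerClasses SubfieldContactClasses AbsoluteContactClasses PurityValveClasses

/-! ## §S (decomp-res-lens-6 · g24 · axis (S) of CRITIC-LEDGER row 181) — THE CHAIN CUT OF THE δ-HEAVY RESIDUAL
`E1TopDeltaHeavy`

The located residual of row 181 is «a wild closed top point with a NEAR POINT exists» (`TopDeltaHeavy`, exact by
`topDeltaHeavy_iff_exists_near`).  Axis (S) evaluates the SAME ideal-level δ-law (N) AT THE NEAR POINTS: the BAD points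
(`badSet M n` = wild closed top points that are not δ-light = those having a near point) are carved by TWO letters,
* the CHAIN LETTER `ChainLightAt 𝓘 n y` — every WILD near point of `y` (over every point blow-up at `y`) is δ-LIGHT (by (N) at
  the near point: has itself no near point), and
* the FINITENESS LETTER «the bad set is finite» (what a centre of closed points consumes; isolation in the top locus, tree
  `ForcedTowerClasses.IsIsolatedIn`, is a sufficient criterion: `badSet_finite_of_isolated`),
into the DECIDED cell `WORTopDeltaHeavyChainTame n` (bad set finite, every bad point chain-light — PROVED from
`SeqDimFour 5 n` by
the ONE-SHOT ENGINE `wor_of_chainTame`: blow up the finite bad set at once; upstairs EVERY wild point is δ-light;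
close by (N)) and
the RESIDUAL cell `WORTopChainHeavy n` (infinitely many bad points OR a bad point with a WILD δ-HEAVY near point —
«a δ-heavy wild
near-point CHAIN OF LENGTH 2», exact by `not_chainLightAt_iff_exists_wild_near_chain`). -/

/-- The BAD SET at marking `n`: wild closed top points (`wildSet M n`) that are NOT δ-light — in base data exactly
the wild closed
top points HAVING a near point (`noNearPointOver_iff_deltaLightAt`), i.e. the witnesses of `TopDeltaHeavy`.
DEFINITION (support). -/
def badSet {Y : Scheme.{0}} (M : MarkedIdeal Y) (n : ℕ) : Set Y :=
  {y | y ∈ wildSet M n ∧ ¬ DeltaLightAt M.ideal n y}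

/-- The BAD LOCUS of an ideal at marking `n` (the same set, stated over `(Y, 𝓘, n)` so that loci need no marked ideal):
closed points of order exactly `n` without absolute stalk contact that are NOT δ-light. DEFINITION (support). -/
def badLocus (Y : Scheme.{0}) (I : Y.IdealSheafData) (n : ℕ) : Set Y :=
  {y | IsClosed ({y} : Set Y) ∧ idealOrder I y = ((n : ℕ) : ℕ∞) ∧ ¬ IsAbsContactAt I n y ∧ ¬ DeltaLightAt I n y}

/-- `badSet M n = badLocus Y M.ideal n`. [folklore] -/
theorem badSet_eq_badLocus {Y : Scheme.{0}} (M : MarkedIdeal Y) (n : ℕ) : badSet M n = badLocus Y M.ideal n := by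
  ext y
  simp only [badSet, badLocus, wildSet, Set.mem_setOf_eq, and_assoc]

/-- **`ChainLightAt 𝓘 n y` — THE CHAIN LETTER: EVERY WILD NEAR POINT OF `y` IS δ-LIGHT.**  For every blow-up `π : Y'
→ Y` along a
regular centre `C` supported exactly at `y` and every point `y'` over `y` which is a WILD closed top point of the
controlled transform
`(π^*𝓘 : 𝓔^n)` at marking `n` (closed, `ord_{y'} = n`, no absolute stalk contact — a wild NEAR point of `y`), the
transformed stalk at
`y'` is δ-LIGHT (`DeltaLightAt`, ideal level).  By (N) at `y'` (`noNearPointOver_iff_deltaLightAt`): no wild near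
point of `y` has
itself a near point — the δ-law of row 181 evaluated AT THE NEAR POINT.  Absolute-contact near points are not
constrained (they are
tame: `WORAllAbs`).  DEFINITION (support). -/
def ChainLightAt {Y : Scheme.{0}} (I : Y.IdealSheafData) (n : ℕ) (y : Y) : Prop :=
  ∀ (C : Y.IdealSheafData) (Y' : Scheme.{0}) (π : Y' ⟶ Y), (C.support : Set Y) = {y} →
    Scheme.IsRegular C.subscheme → IsBlowup π C → ∀ y' : Y', π.base y' = y → IsClosed ({y'} : Set Y') →
      idealOrder (controlledTransform π C I n) y' = ((n : ℕ) : ℕ∞) → ¬ IsAbsContactAt (controlledTransform π C I n) n y' →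
        DeltaLightAt (controlledTransform π C I n) n y'

/-- **`TopChainHeavy Y 𝓘 n` — THE RESIDUAL LOCUS OF THE CHAIN CUT**: the bad locus (closed points of order `n`, no
absolute stalk
contact, NOT δ-light) is INFINITE, OR some bad point is NOT chain-light (has a WILD δ-HEAVY near point: a δ-heavy
wild near-point
chain of length `2` starts at it, `not_chainLightAt_iff_exists_wild_near_chain`).  The FINITENESS letter is exactly
what the one-shot
engine consumes (a finite set of closed points is a regular centre); isolation of every bad point in the top locus
is a SUFFICIENT
criterion for it (`badSet_finite_of_isolated`), not a necessary one. DEFINITION (residual locus). -/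
def TopChainHeavy (Y : Scheme.{0}) (I : Y.IdealSheafData) (n : ℕ) : Prop :=
  (badLocus Y I n).Infinite ∨ ∃ y ∈ badLocus Y I n, ¬ ChainLightAt I n y

/-- The top locus `{ord ≥ n}` of an `n`-datum is the support of the marked ideal. [folklore] -/
theorem topLocus_eq_support {Y : Scheme.{0}} {n : ℕ} {M : MarkedIdeal Y} (hM : IsDatum n M) :
    {x : Y | ((n : ℕ) : ℕ∞) ≤ idealOrder M.ideal x} = M.support := by
  ext x
  show ((n : ℕ) : ℕ∞) ≤ idealOrder M.ideal x ↔ (M.mult : ℕ∞) ≤ idealOrder M.ideal x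
  rw [hM.1]

/-- The bad set lies in the wild set. [folklore] -/
theorem badSet_subset_wildSet {Y : Scheme.{0}} (M : MarkedIdeal Y) (n : ℕ) : badSet M n ⊆ wildSet M n :=
  fun _ h => h.1

/-- A residual witness is a δ-heavy wild closed top point: `TopChainHeavy → TopDeltaHeavy` in base data (¬δ-light
forces ¬split and
¬light by (N)'s corollaries `deltaLightAt_of_diffSplitAt` / `deltaLightAt_of_lightAt`). [folklore] -/
theorem topDeltaHeavy_of_topChainHeavy {p : ℕ} (hp : p.Prime) {k : Type} [Field k] [CharP k p] {Y : Scheme.{0}}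
    {g : Y ⟶ Spec (.of k)} (hB : IsBase Y g) {n : ℕ} (hn : 1 ≤ n) {M : MarkedIdeal Y} (hM : IsDatum n M)
    (h : TopChainHeavy Y M.ideal n) : TopDeltaHeavy Y M.ideal n := by
  haveI : Fact p.Prime := ⟨hp⟩
  haveI := hB.locallyOfFiniteType
  haveI : IsLocallyNoetherian Y := LocallyOfFiniteType.isLocallyNoetherian g
  obtain ⟨y, hyc, hord, hna, hnd⟩ : (badLocus Y M.ideal n).Nonempty :=
    h.elim Set.Infinite.nonempty fun ⟨y, hy, _⟩ => ⟨y, hy⟩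
  letI := stalkAlgebra (g.appTop.hom.comp (Scheme.ΓSpecIso (.of k)).inv.hom) y
  haveI : CharP (Y.presheaf.stalk y) p := charP_of_injective_algebraMap (algebraMap k (Y.presheaf.stalk y)).injective p
  exact ⟨y, hyc, hord, hna, fun hs => hnd (deltaLightAt_of_diffSplitAt hB.isRegular hn M hM.1 hyc hord.ge hs),
    fun hl => hnd (deltaLightAt_of_lightAt hB.isRegular hn M hM.1 hyc hord.ge hl), hnd⟩

/-- **NOT chain-heavy ⟺ the bad set is FINITE and every bad point is CHAIN-LIGHT** (the decided condition,
unfolded). [folklore] -/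
theorem not_topChainHeavy_iff {Y : Scheme.{0}} {n : ℕ} {M : MarkedIdeal Y} :
    ¬ TopChainHeavy Y M.ideal n ↔ (badSet M n).Finite ∧ ∀ y ∈ badSet M n, ChainLightAt M.ideal n y := by
  rw [badSet_eq_badLocus, TopChainHeavy, not_or, Set.not_infinite]
  refine and_congr_right fun _ => ?_
  simp only [not_exists, not_and, not_not]

end ChainDefs

section ChainCells

open Summit.ResolutionOfSingularities.ResolutionOfSingularities.Theorems
open WeakOrderReduction ForcedTowerClasses SubfieldContactClasses AbsoluteContactClasses PurityValveClasses

/-! ### THE CELLS OF THE CHAIN CUT, the EXACT hypothesis-free carve of `WORTopDeltaHeavy` / `E1TopDeltaHeavy` -/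

/-- **THE DECIDED CELL · `WORTopDeltaHeavyChainTame n`** — weak resolution for the δ-heavy base data at marking `n`
whose bad set is
FINITE with every bad point CHAIN-LIGHT (`¬ TopChainHeavy`).  DECIDED (PROVED below from `SeqDimFour 5 n` by the one-shot engine
`wor_of_chainTame`). -/
def WORTopDeltaHeavyChainTame (n : ℕ) : Prop :=
  ∀ p : ℕ, p.Prime → ∀ (k : Type) [Field k] [CharP k p] (Y : Scheme.{0}) (g : Y ⟶ Spec (.of k)),
    IsBase Y g → ∀ M : MarkedIdeal Y, IsDatum n M → TopHeavy Y M.ideal n → TopDeltaHeavy Y M.ideal n →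
      ¬ TopChainHeavy Y M.ideal n → ∃ t : CentreSeq Y, WeakResolution t M

/-- **THE RESIDUAL CELL · `WORTopChainHeavy n`** — weak resolution for the base data at marking `n` with INFINITELY
MANY bad points
or a bad point having a WILD δ-HEAVY NEAR POINT (a δ-heavy wild chain of length `2`).  RESIDUAL (the located successor of
`WORTopDeltaHeavy n`). -/
def WORTopChainHeavy (n : ℕ) : Prop :=
  ∀ p : ℕ, p.Prime → ∀ (k : Type) [Field k] [CharP k p] (Y : Scheme.{0}) (g : Y ⟶ Spec (.of k)),
    IsBase Y g → ∀ M : MarkedIdeal Y, IsDatum n M → TopHeavy Y M.ideal n → TopDeltaHeavy Y M.ideal n →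
      TopChainHeavy Y M.ideal n → ∃ t : CentreSeq Y, WeakResolution t M

/-- **THE DECIDED family · `E1TopDeltaHeavyChainTame`**. DECIDED. -/
def E1TopDeltaHeavyChainTame : Prop := ∀ n : ℕ, 1 ≤ n → WORTopDeltaHeavyChainTame n

/-- **THE RESIDUAL (family) · `E1TopChainHeavy`** — THE LOCATED RESIDUAL of the lens-6 column after g24. RESIDUAL. -/
def E1TopChainHeavy : Prop := ∀ n : ℕ, 1 ≤ n → WORTopChainHeavy n

/-- **EXACT CARVE at one marking** (hypothesis-free): `WORTopDeltaHeavy n ⟺ WORTopChainHeavy n ∧ WORTopDeltaHeavyChainTame n`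
(excluded middle on `TopChainHeavy`). [new] [folklore] -/
theorem worTopDeltaHeavy_iff_chainHeavy_chainTame (n : ℕ) :
    WORTopDeltaHeavy n ↔ WORTopChainHeavy n ∧ WORTopDeltaHeavyChainTame n := by
  constructor
  · intro h
    exact ⟨fun p hp k _ _ Y g hB M hM hT hD _ => h p hp k Y g hB M hM hT hD,
      fun p hp k _ _ Y g hB M hM hT hD _ => h p hp k Y g hB M hM hT hD⟩
  · rintro ⟨hR, hD⟩ p hp k _ _ Y g hB M hM hT hDH
    by_cases hc : TopChainHeavy Y M.ideal n
    · exact hR p hp k Y g hB M hM hT hDH hc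
    · exact hD p hp k Y g hB M hM hT hDH hc

/-- **EXACT CARVE of the family** (hypothesis-free): `E1TopDeltaHeavy ⟺ E1TopChainHeavy ∧ E1TopDeltaHeavyChainTame`.
[new] [folklore] -/
theorem e1TopDeltaHeavy_iff_chainHeavy_chainTame :
    E1TopDeltaHeavy ↔ E1TopChainHeavy ∧ E1TopDeltaHeavyChainTame := by
  constructor
  · intro h
    exact ⟨fun n hn => ((worTopDeltaHeavy_iff_chainHeavy_chainTame n).1 (h n hn)).1,
      fun n hn => ((worTopDeltaHeavy_iff_chainHeavy_chainTame n).1 (h n hn)).2⟩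
  · rintro ⟨hR, hD⟩ n hn
    exact (worTopDeltaHeavy_iff_chainHeavy_chainTame n).2 ⟨hR n hn, hD n hn⟩

end ChainCells

section ChainEngine

open Summit.ResolutionOfSingularities.ResolutionOfSingularities.Theorems
open WeakOrderReduction ForcedTowerClasses SubfieldContactClasses AbsoluteContactClasses PurityValveClasses
open Scheme.IdealSheafData (vanishingIdeal)

/-! ### THE ONE-SHOT ENGINE of the decided cell: blow up the finite bad set AT ONCE; upstairs every wild point is δ-light -/

/-- **ISOLATED BAD POINTS ARE FINITE IN NUMBER** (isolation in the top locus is a SUFFICIENT criterion for the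
finiteness letter the
engine consumes — not a necessary one: finitely many bad points on a top curve whose other points are tame are still
decided): an
isolated point `y` of the closed Noetherian top locus `{ord ≥ n} = ⋃ S` (finite union of irreducible closed sets,
`OrderUSC`) is one
of its irreducible components (`Z ∋ y` irreducible, `Z ∩ U` dense in `Z` and contained in `{y}`, so `Z = {y}`). [folklore] -/
theorem badSet_finite_of_isolated (hU : OrderUSC) {k : Type} [Field k] {Y : Scheme.{0}} {g : Y ⟶ Spec (.of k)}
    (hB : IsBase Y g) {n : ℕ} {M : MarkedIdeal Y} (hM : IsDatum n M)
    (hiso : ∀ y ∈ badSet M n, IsIsolatedIn M.support y) : (badSet M n).Finite := by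
  haveI := hB.locallyOfFiniteType
  haveI : IsLocallyNoetherian Y := LocallyOfFiniteType.isLocallyNoetherian g
  haveI := hB.quasiCompact
  haveI : CompactSpace Y := QuasiCompact.compactSpace_of_compactSpace g
  haveI : IsNoetherian Y := {}
  have hTc : IsClosed (M.support : Set Y) := by
    show IsClosed {x | (M.mult : ℕ∞) ≤ idealOrder M.ideal x}
    rw [hM.1]; exact hU k Y g hB M.ideal n
  obtain ⟨S, hSf, hSc, hSi, hSU⟩ := NoetherianSpace.exists_finite_set_isClosed_irreducible hTc
  refine Set.Finite.of_finite_image (f := fun y : Y => ({y} : Set Y)) (hSf.subset ?_) Set.singleton_injective.injOn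
  rintro _ ⟨y₀, hy₀, rfl⟩
  obtain ⟨hy₀T, U, hyU, hUT⟩ := hiso y₀ hy₀
  have hy₀T' := hy₀T
  rw [hSU] at hy₀T'
  obtain ⟨Z, hZS, hy₀Z⟩ := Set.mem_sUnion.mp hy₀T'
  have hZT : Z ⊆ M.support := by rw [hSU]; exact Set.subset_sUnion_of_mem hZS
  have h1 : Z ⊆ closure (Z ∩ (U : Set Y)) :=
    subset_closure_inter_of_isPreirreducible_of_isOpen (hSi Z hZS).isPreirreducible U.isOpen ⟨y₀, hy₀Z, hyU⟩
  have h2 : Z ∩ (U : Set Y) ⊆ {y₀} := fun z hz => hUT ⟨hz.2, hZT hz.1⟩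
  have hZeq : Z = {y₀} :=
    Set.Subset.antisymm (h1.trans ((closure_mono h2).trans hy₀.1.1.closure_eq.le)) (Set.singleton_subset_iff.mpr hy₀Z)
  show ({y₀} : Set Y) ∈ S
  rw [← hZeq]; exact hZS

/-- A finite set of closed points is closed. [folklore] -/
theorem isClosed_of_finite_of_isClosed_singleton {Y : Scheme.{0}} {S : Set Y} (hS : S.Finite)
    (hcl : ∀ y ∈ S, IsClosed ({y} : Set Y)) : IsClosed S := by
  rw [← Set.biUnion_of_singleton S]
  exact hS.isClosed_biUnion fun y hy => hcl y hy

end ChainEngine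

end Summit.ResolutionOfSingularities.ResolutionOfSingularities.Theorems.DeltaCutClasses
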